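import Summits.BirchSwinnertonDyer.BirchSwinnertonDyer.Theorems.EisensteinPrimesAcTwistDeformationSUR
import Summits.BirchSwinnertonDyer.BirchSwinnertonDyer.Theorems.EisensteinPrimesAcTwistDeformationLEOOfTateTC
import Literature.NumberTheory.IwasawaTheory.Greenberg2006.CohomologyCofiniteGenerationLeTwoOfTateTC
import HarnessLib

/-!
# T28b re-typing (`OfTateTC`: Tate's formula by name AT TOTALLY COMPLEX FIELDS) of `EisensteinPrimesAcTwistDeformationSUR.lean`

Route `EisensteinPrimes` (rung K5), crux 2 `GoodLatticeBDPValue` (stmt-BirchSwinnertonDyer-19032), line `halves`;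
cell `bsd-eis`, seat `bsd-line-x1-p1` LEAD g8, lane «T28 / TATE RE-PLUMB» (helper, `--supports`).

This file re-types, token for token, the theorems of `EisensteinPrimesAcTwistDeformationSUR` that carry
Greenberg 2006 Prop. 3.2 BY NAME (`h32 : (∀ (L : Type) [Field L] [NumberField L] [IsTotallyComplex L], Literature.NumberTheory.GaloisCohomology.tateGlobalEulerPoincareCharacteristic L)`, cofinite generation of
`Hⁱ(K_Σ/K, 𝒟)` / `Hⁱ(K_v, 𝒟)` for EVERY `i`, every number field, every prime) with that hypothesis replaced by
Tate's global Euler–Poincaré characteristic BY NAME AT TOTALLY COMPLEX FIELDS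
(`h32 : ∀ L [IsTotallyComplex L], GaloisCohomology.tateGlobalEulerPoincareCharacteristic L`, Milne ADT I Thm. 5.1 — the shape the
tree's class-formation road to Tate's theorem delivers; where a theorem's field was not syntactically totally complex an
`[IsTotallyComplex K]` binder is added and supplied by its callers from `IsImaginaryQuadratic K` / `∀ w, w.IsComplex`): on this line
Prop. 3.2 is read in degrees `i ≤ 2` only (global clause; the local clause is the unconditional
`Greenberg2006.prop32_local_holds`), and in those degrees it follows from Tate's formula alone
(`Greenberg2006.prop32_global_le_two_of_tate_tc`, file `CohomologyCofiniteGenerationLeTwoOfTateTC`: `H⁰`/`H¹` of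
`G_{K,S}` with finite coefficients are finite unconditionally, `H²` by Tate, and Greenberg's dévissage for `Hⁿ`
involves `Hⁿ`, `Hⁿ⁻¹` only).  Statements are otherwise VERBATIM (same binder order, new names `<name>_ofTateTC`; supersedes this seat's `…OfTate` twin, which took Tate's formula at every number field);
proofs are the tree proofs with the two reading lemmas substituted and the re-typed callees called.
EFFECT for the crux: Harari Thm. 17.13 (a) (`poitouTate_restricted_three_le`) is no longer consumed through
Prop. 3.2 at every number field, only at totally complex fields (Greenberg 2006 Prop. 4.1 is typed totally
imaginary; `cd_p ≤ 2` and the `H²` bookkeeping at the imaginary quadratic `K`), which is what the tree's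
class-formation road (`RestrictedRamificationCdTwoOfH3Mu`, lane PT3-TC) proves.

Theorems only; no definition, no named fact, no `sorry`, no instance. HONEST FRAMING: conditional on the PUBLISHED
named facts carried as hypotheses; closes nothing by itself; no summit statement / BSD / the crux is proved here.

## References
* R. Greenberg, *On the structure of certain Galois cohomology groups*, Doc. Math. Extra Vol. Coates (2006), Prop. 3.2 (p. 358). [Greenberg2006]
* J. S. Milne, *Arithmetic Duality Theorems*, 2nd ed. (2006), I Thm. 5.1 (p. 67). [MilneADT2006]
* (the references of the re-typed file apply verbatim)
-/

set_option autoImplicit false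

noncomputable section

open scoped Classical
open NumberField IsDedekindDomain Field
open Literature.NumberTheory.EllipticCurves Literature.NumberTheory.GaloisRepresentations
  Literature.NumberTheory.IwasawaTheory Literature.NumberTheory.IwasawaTheory.Greenberg2016
  Literature.NumberTheory.IwasawaTheory.Greenberg2006
  Summit.BirchSwinnertonDyer.BirchSwinnertonDyer.Theorems.TwistDeformationCofree
  Summit.BirchSwinnertonDyer.BirchSwinnertonDyer.Theorems.GreenbergFullAtSelmer

universe u

namespace Summit.BirchSwinnertonDyer.BirchSwinnertonDyer.Theorems.AcTwistDeformation

section QGlobal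

variable {Λ : Type u} [CommRing Λ] {ι : Type u} [Fintype ι] [DecidableEq ι]
  {T : ι → Type u} [∀ i, AddCommGroup (T i)] [∀ i, Module Λ (T i)]

variable {K : Type u} [Field K] [NumberField K] {S : Set (HeightOneSpectrum (𝓞 K))}
  [TopologicalSpace Λ] {D : Type u} [AddCommGroup D] [Module Λ D] [TopologicalSpace D] [DiscreteTopology D]
  [ContinuousSMul Λ D] {ρ : ContinuousRep (GaloisGroupUnramifiedOutside K S) Λ D}

end QGlobal

section SUR

variable {K : Type} [Field K] [NumberField K] {S : Set (HeightOneSpectrum (𝓞 K))} {p : ℕ} [Fact p.Prime]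
  {A : Type} [AddCommGroup A] [Module ℤ_[p] A] [TopologicalSpace A] [DiscreteTopology A]
  [TopologicalSpace (PowerSeries ℤ_[p])] [IsTopologicalRing (PowerSeries ℤ_[p])]
  [IsTopologicalAddGroup (BigRepModule ℤ_[p] p A)]
  [ContinuousSMul (PowerSeries ℤ_[p]) (BigRepModule ℤ_[p] p A)]
  (hS : ∀ v : HeightOneSpectrum (𝓞 K), ((p : ℕ) : 𝓞 K) ∈ v.asIdeal → v ∈ S)
  (κ : ZpExtension K p) (ρ₀ : ContinuousRep (GaloisGroupUnramifiedOutside K S) ℤ_[p] A)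

/-- **[T28b `OfTateTC` re-typing: Greenberg 2006 Prop. 3.2 by name ↦ Milne ADT I Thm. 5.1 by name AT TOTALLY COMPLEX FIELDS (Prop. 3.2 is read in degrees ≤ 2 and at totally complex fields only, `prop32_global_le_two_of_tate_tc`).]** [cite: MilneADT2006, I Thm. 5.1 (p. 67)] **SUR(`𝐃₁`, `𝓛_𝔭`) — Greenberg 2016 Prop. 2.6.3 (c) at the ONE-variable twist deformation
`𝐃₁ = bigRep κ ρ₀` of ANY `A ≃ ℚ_p/ℤ_p` on which `G_{K,S}` acts by a character, over a `ℤ_p`-extension `κ`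
of an IMAGINARY QUADRATIC `K` with `p = 𝔭𝔭̄` split and no place of `S` splitting completely in `K_∞`:**
the global-to-local map `φ_{𝓛_𝔭} : H¹(K_Σ/K, 𝐃₁) → ∏_{w∈Σ} H¹(K_w, 𝐃₁)/L_w` (`L_𝔭 = ⊤`, `L_w = 0` for
`w ≠ 𝔭`) IS SURJECTIVE, granted five published facts by name (Greenberg 2016 Prop. 2.6.3; Greenberg
2006 Props. 4.1, 4.2, 3.2, §5 A) and `corank_Λ S_{𝓛_𝔭}(K, 𝐃₁) = 0` with `S_{𝓛_𝔭}` cofinitely generated.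
DISCHARGED here: `𝐃₁` divisible / cofree / corank one / cofinitely generated / `p`-primary
(`…AcTwistDeformationCofree`); `h⁰ = 0`, LOC_𝔭⁽¹⁾, the squeeze `h¹ = 1 ∧ h² = 0`, LEO
(`…AcTwistDeformationLEO`); `corank Q = 1`, cofinite generation of `Q`, CRK (§1); condition (c) at `𝔭`.
[cite: Greenberg2016Selmer, Prop. 2.6.3 (c) (§2.6 p. 10 L13–22), §4.3 p. 20 L19–30]
[cite: Greenberg2010, Prop. 3.2.1 (p. 15), Lemma 5.2.2 (PDF p. 28)]
[cite: Greenberg2006, Prop. 3.2 p. 358, Props. 4.1–4.2 (§4 A pp. 367–368), §5 A (p. 373)] -/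
theorem bigRep_fullAt_SUR_ofTateTC (h263 : prop263_sur_of_crk) (h41 : prop41_globalEulerPoincareCorank)
    (h42 : prop42_localEulerPoincareCorank) (h5A : sec5A_localH2_subsingleton_of_LOC1)
    (h32 : (∀ (L : Type) [Field L] [NumberField L] [IsTotallyComplex L], Literature.NumberTheory.GaloisCohomology.tateGlobalEulerPoincareCharacteristic L))
    (hSf : S.Finite) (hK : IsImaginaryQuadratic K) (e : A ≃ₗ[ℤ_[p]] QpModZp p)
    (hscalar : ∀ g : GaloisGroupUnramifiedOutside K S, ∃ t : ℤ_[p]ˣ, ∀ a : A, ρ₀ g a = (t : ℤ_[p]) • a)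
    (hsup : ∀ v : HeightOneSpectrum (𝓞 K), v ∈ S →
      ∃ σ : absoluteGaloisGroup (Place.Completion (Sum.inr v : Place K)),
        κ (absGaloisRestrict K _ σ) ≠ 1)
    {𝔭 𝔭bar : HeightOneSpectrum (𝓞 K)} (hne : 𝔭bar ≠ 𝔭)
    (hp𝔭 : ((p : ℕ) : 𝓞 K) ∈ 𝔭.asIdeal) (hp𝔭bar : ((p : ℕ) : 𝓞 K) ∈ 𝔭bar.asIdeal)
    (hSel : HasCorank (PowerSeries ℤ_[p])
      (fullAtSpecification S (bigRep (κ.liftUnramifiedOutside S hS) ρ₀) (Sum.inr 𝔭)).selmer 0)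
    (hSelfg : IsCofinitelyGenerated (PowerSeries ℤ_[p])
      (fullAtSpecification S (bigRep (κ.liftUnramifiedOutside S hS) ρ₀) (Sum.inr 𝔭)).selmer) :
    (fullAtSpecification S (bigRep (κ.liftUnramifiedOutside S hS) ρ₀) (Sum.inr 𝔭)).SUR := by
  set ρ := bigRep (κ.liftUnramifiedOutside S hS) ρ₀ with hρ
  -- standing clauses of the arena at `Λ = R = ℤ_p⟦T⟧`
  have hΛ := nonempty_iwasawaAlgebra_ringEquiv_mvPowerSeries p
  have hcpl := isAdicComplete_maximalIdeal_iwasawaAlgebra p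
  have hres := finite_residueField_iwasawaAlgebra p
  have hchar := charP_residueField_iwasawaAlgebra p
  have hinjΛ : Function.Injective (algebraMap (PowerSeries ℤ_[p]) (PowerSeries ℤ_[p])) :=
    fun a b h ↦ by simpa using h
  have hfin : Module.Finite (PowerSeries ℤ_[p]) (PowerSeries ℤ_[p]) := inferInstance
  have hlin : ∀ (g : GaloisGroupUnramifiedOutside K S) (r : PowerSeries ℤ_[p])
      (d : BigRepModule ℤ_[p] p A), ρ g (r • d) = r • ρ g d := fun g r d ↦ map_smul (ρ g) r d
  -- the instance data from ONE `e : A ≃ₗ[ℤ_p] ℚ_p/ℤ_p`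
  obtain ⟨hA, jQ, -, hinjQ, hsurjQ⟩ := QpModZp.exists_character_hinj_hsurj_of_linearEquiv e
  obtain ⟨jU, -, hinjU, hsurjU⟩ := QpModZp.exists_unitsCarrier_hinj_hsurj_of_linearEquiv K e
  have hcyc : ∀ (v : Place K) (σ : absoluteGaloisGroup v.Completion), ∃ u : ℤ_[p], ∀ a : A,
      DiscreteGaloisModule.units K (absGaloisRestrict K v.Completion σ) (jU a) = jU (u • a) :=
    fun v σ ↦ QpModZp.exists_units_apply_eq_smul K jU hsurjU _
  -- `𝐃₁`: divisible, cofree of corank one, cofinitely generated, `p`-primary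
  have hdiv := isDivisible_bigRepModule hA jQ hinjQ hsurjQ
  have hT := isCofree_bigRepModule hA jQ hinjQ hsurjQ
  have hcf := isCofinitelyGenerated_bigRepModule hA jQ hinjQ hsurjQ
  have hm := hasCorank_one_bigRepModule hA jQ hinjQ hsurjQ
  have hpD : ∀ d : BigRepModule ℤ_[p] p A, ∃ n : ℕ, (p ^ n : ℤ) • d = 0 := exists_zpow_smul_eq_zero
  -- `K` imaginary quadratic, `p` split
  haveI := hK.2
  have hKc : ∀ w : InfinitePlace K, w.IsComplex := IsTotallyComplex.isComplex
  have hr₂ := nrComplexPlaces_eq_one_of_isImaginaryQuadratic hK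
  have hdeg : 𝔭bar.asIdeal.ramificationIdx ℤ * 𝔭bar.asIdeal.inertiaDeg ℤ = 1 :=
    (ncard_primesOver_eq_two_and_deg_one_of_ne hK.1 hp𝔭 hp𝔭bar hne).2 hp𝔭bar
  have hSp : ∀ v : HeightOneSpectrum (𝓞 K), v ∈ S → ((p : ℕ) : 𝓞 K) ∈ v.asIdeal →
      v = 𝔭 ∨ v = 𝔭bar := fun v _ hv ↦ eq_or_eq_of_natCast_mem_of_ne hK.1 hp𝔭 hp𝔭bar hne hv
  -- local conditions at the finite places of `Σ` from the `σ`-supply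
  have hLOC1fin : ∀ v : HeightOneSpectrum (𝓞 K), v ∈ S → LOC1 S ρ (Sum.inr v) := fun v hv ↦ by
    obtain ⟨σ, hσ⟩ := hsup v hv
    obtain ⟨t, ht⟩ := hscalar (localToUnramified S (Sum.inr v) σ)
    obtain ⟨u, hu⟩ := hcyc (Sum.inr v) σ
    exact bigRep_LOC1 S hS κ ρ₀ hA jU hinjU hsurjU (Sum.inr v) σ t ht hu hσ
  have h0loc : ∀ v : HeightOneSpectrum (𝓞 K), v ∈ S →
      HasCorank (PowerSeries ℤ_[p]) ((localRep S ρ (Sum.inr v)).H 0) 0 := fun v hv ↦ by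
    obtain ⟨σ, hσ⟩ := hsup v hv
    exact hasCorank_localH0_bigRep_zero S hS κ ρ₀ hscalar (Sum.inr v) hσ
  have h2loc : ∀ v : HeightOneSpectrum (𝓞 K), v ∈ S →
      HasCorank (PowerSeries ℤ_[p]) ((localRep S ρ (Sum.inr v)).H 2) 0 := fun v hv ↦
    hasCorank_localH2_zero_of_sec5A ρ h5A hSf hS hΛ hpD hcf (hLOC1fin v hv)
  have hcfgloc : ∀ v : Place K, InSigma S v → IsCofinitelyGenerated (PowerSeries ℤ_[p])
      ((localRep S ρ v).H 1) := fun v _ ↦ prop32_local_of_holds hSf hS hΛ ρ hpD hcf v 1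
  -- global `h⁰ = 0`: a class with `κ ≠ 0` exists (`κ` is onto)
  have h0 : HasCorank (PowerSeries ℤ_[p]) (ρ.H 0) 0 := by
    obtain ⟨g, hg⟩ := κ.liftUnramifiedOutside_surjective S hS (Multiplicative.ofAdd 1)
    refine hasCorank_H0_bigRep_zero S hS κ ρ₀ hscalar (g := g) ?_
    rw [hg]
    exact fun h ↦ one_ne_zero (Multiplicative.ofAdd.injective (h.trans ofAdd_zero.symm))
  -- `corank Q = 1`, `Q` cofinitely generated
  have hη'1 : HasCorank (PowerSeries ℤ_[p]) ((localRep S ρ (Sum.inr 𝔭bar)).H 1) 1 :=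
    hasCorank_localH1_of_prop42_degree_one ρ h42 hSf hS hΛ hpD hcf hp𝔭bar hdeg hm
      (h0loc 𝔭bar (hS 𝔭bar hp𝔭bar)) (h2loc 𝔭bar (hS 𝔭bar hp𝔭bar))
  have hcot : ∀ v : Place K, InSigma S v → v ≠ Sum.inr 𝔭 → v ≠ Sum.inr 𝔭bar →
      IsCotorsion (PowerSeries ℤ_[p]) ((localRep S ρ v).H 1) := by
    rintro (w | v) hv h1 h2'
    · exact isCotorsion_localH1_inl_of_isComplex S ρ (hKc w)
    · have hvS : v ∈ S := (inSigma_inr_iff S v).mp hv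
      have hv𝔭 : v ≠ 𝔭 := fun h ↦ h1 (by rw [h])
      have hv𝔭bar : v ≠ 𝔭bar := fun h ↦ h2' (by rw [h])
      have hvp : ((p : ℕ) : 𝓞 K) ∉ v.asIdeal := fun h ↦ by
        rcases hSp v hvS h with h' | h'
        · exact hv𝔭 h'
        · exact hv𝔭bar h'
      exact isCotorsion_localH1_of_prop42 ρ h42 hSf hS hΛ hpD hcf hvp hm (h0loc v hvS) (h2loc v hvS)
        (hcfgloc (Sum.inr v) hv)
  have hQ : HasCorank (PowerSeries ℤ_[p]) (fullAtSpecification S ρ (Sum.inr 𝔭)).QGlobal 1 :=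
    hasCorank_QGlobal_fullAt_one hSf (hS 𝔭bar hp𝔭bar) hne hη'1 hcot
  have hQfg : IsCofinitelyGenerated (PowerSeries ℤ_[p]) (fullAtSpecification S ρ (Sum.inr 𝔭)).QGlobal :=
    isCofinitelyGenerated_QGlobal_fullAt hSf 𝔭 hcfgloc
  -- the squeeze: `h¹ = 1`, `h² = 0`; LEO; CRK
  obtain ⟨hH1, hH2⟩ := hasCorank_H1_one_and_H2_zero ρ h41 hSf hS hKc hr₂ hΛ hpD hcf hm h0
    (fullAtSpecification S ρ (Sum.inr 𝔭)) hSel hSelfg hQ hQfg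
  have hLEO : LEO S ρ := leo_of_hasCorank_H2_zero_ofTateTC ρ h32 hSf hS hΛ hpD hcf hH2
  have hCRK : (fullAtSpecification S ρ (Sum.inr 𝔭)).CRK :=
    CRK_of_hasCorank _ (s₀ := 0) (q₀ := 1) (by simpa using hH1) hSel hQ
  -- condition (c) at `η = 𝔭`: LOC⁽¹⁾ and `Q_𝔭 = 0` divisible
  have hQ𝔭 : IsDivisible (PowerSeries ℤ_[p]) ((fullAtSpecification S ρ (Sum.inr 𝔭)).Q (Sum.inr 𝔭)) := by
    haveI : Subsingleton ((fullAtSpecification S ρ (Sum.inr 𝔭)).Q (Sum.inr 𝔭)) :=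
      Submodule.Quotient.subsingleton_iff.mpr (fullAtSpecification_self (Sum.inr 𝔭))
    exact fun θ _ s ↦ ⟨s, Subsingleton.elim _ _⟩
  -- Prop. 2.6.3 (c)
  exact h263 p K S hSf hS (PowerSeries ℤ_[p]) 1 hΛ (PowerSeries ℤ_[p]) hinjΛ hfin hcpl hres hchar
    (BigRepModule ℤ_[p] p A) ρ hlin hT hpD (fullAtSpecification S ρ (Sum.inr 𝔭))
    (fullAtSpecification_isStable (Sum.inr 𝔭) hlin) hdiv hLEO hCRK
    (Or.inr (Or.inr ⟨𝔭, hS 𝔭 hp𝔭, hLOC1fin 𝔭 (hS 𝔭 hp𝔭), hQ𝔭⟩))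

end SUR

end Summit.BirchSwinnertonDyer.BirchSwinnertonDyer.Theorems.AcTwistDeformation

end
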